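import Summits.MatrixMultiplication.OmegaCensus.DominoNormUnitEquation
import Mathlib.Algebra.BigOperators.Fin
import Mathlib.RingTheory.Coprime.Lemmas
import HarnessLib

/-!
# The norm congruence for domino cube law triples: `|B| ∣ (3d²)^{p−1} − 1`

ω-census `pub-omega`, family (b3), seat pub-omega-group gen 30.  Framing: lottery ticket; floor = certified bounds/negative
ranges.  VALUE: an all-`p` kernel theorem for the domino column of the Dih-side `|A| ≡ 1 (mod 3)` classification (every
quotient `ℤ_p × ℤ_p`, indeed every exponent-`p` quotient, of every order at once); NOT progress on ω.

**Theorem (`card_dvd_of_shifted_line_identity`).**  Let `B` be a finite abelian group of exponent `p`, `p ≥ 5` prime, and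
let `F, G : B → ℕ`, `b₁ b₂ s : B`, `K : ℕ` satisfy the shifted line identity of `DominoShiftedForm.radon_identity_shifted`
(the fibre counts of a domino cube law triple `(1,1 | d,d | e,e)` over any `A ↠ B` do, with `Σ F = d`, `Σ G = e`):
`Σ_u (F(t−u) + F(u−(t−b₁)) + F((t−b₂)+u))·G(u) + [s = t] = K` for every `t`.  Then
`|B| ∣ (3 (Σ F)²)^{p−1} − 1` and `|B| ∣ (3 (Σ G)²)^{p−1} − 1`.

Proof (the norm argument of de Caen–Gregory–Hughes–Kreher for near-factorisations, `|A|^{p−1} ≡ 1 (mod p^m)`, run on the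
twisted discriminant instead of on the set).  At a non-trivial character `χ` the identity reads `ab + βāb + γab̄ = −χ(s)`
(`a = χ(F)`, `b = χ(G)`, `β = χ(b₁)`, `γ = χ(b₂)`; `char_identity`), and the polynomial identity
`D_β(a)·D_γ(b) = u² − βγ·u·ū + β²γ²·ū²`, `D_β(a) = a² + βaā + β²ā²` (`Dsh_mul_Dsh`) makes `D_β(a)D_γ(b)` an explicit unit:
over the `p − 1` powers `χ = ψ^j` the product of these units is `∏_j ξ^j · ∏_j (θ^j + θ^{−j} − 1) = 1`
(`DominoNormCharacters`).  Hence `𝒩_F(ψ) := ∏_{j≠0} D(ψ^j)` satisfies `𝒩_F 𝒩_G = 1`; `𝒩_F` is a rational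
(Galois averaging over `l ↦ ψ^l`, `exists_rat_prodD`) algebraic integer, hence an integer, and a nonnegative real (pairing `j`
with `−j`), so `𝒩_F(ψ) = 1` for EVERY `ψ ≠ 0`.  But `∏_{j : ZMod p} D(ψ^j) = Σ_b E(b) ψ(b)` for one integer-valued `E`
(`normD_eq_charsum`, expanding the product), with `Σ E = (3d²)^p` and value `3d²` at every `ψ ≠ 0`; Fourier inversion gives
`|B| ∣ (3d²)^p − 3d²`, and `gcd(|B|, 3d) = 1` (`3de + 1 = K|B|`).
For `B = ℤ_p × ℤ_p` this is `(3d²)^{p−1} ≡ 1 (mod p²)`: of the 11 664 domino cells `(1,d,e)`, `3de + 1 = p²`,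
`5 ≤ p < 3000`, exactly 20 satisfy it (`p ≤ 31`: only `(1,4,4)@49`, `(1,1,40)@121`, `(1,7,8)@169`).
-/

namespace Summit.MatrixMultiplication.OmegaCensus.DominoNorm

open Finset

/-! ## The norm over the `p − 1` powers of a character -/

section Norm

variable {B : Type*} [AddCommGroup B] [Fintype B] [DecidableEq B] {p : ℕ} [hp : Fact p.Prime]

/-- `D(F, ψ^j) D(G, ψ^j) = ξ^j (θ^j + θ'^j − 1)` with `ξ = ψ(b₁+b₂)`, `θ = ψ(2s − b₁ − b₂)`, `θ' = ψ(b₁ + b₂ − 2s)`. [folklore] -/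
theorem Dval_mul_Dval_pow (hexp : ∀ b : B, p • b = 0) (F G : B → ℕ) (b₁ b₂ s : B) (K : ℕ)
    (hID : ∀ t : B, (∑ u, (F (t - u) + F (u - (t - b₁)) + F ((t - b₂) + u)) * G u) +
      (if s = t then 1 else 0) = K)
    {ψ : AddChar B ℂ} (hψ : ψ ≠ 0) {j : ZMod p} (hj : j ≠ 0) :
    Dval F b₁ (ψ ^ j.val) * Dval G b₂ (ψ ^ j.val) =
      ψ (b₁ + b₂) ^ j.val * (ψ (2 • s - b₁ - b₂) ^ j.val + ψ (b₁ + b₂ - 2 • s) ^ j.val - 1) := by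
  rw [Dval_mul_Dval F G b₁ b₂ s K hID (addChar_pow_ne_zero hexp hψ hj)]
  simp only [AddChar.pow_apply]
  have e1 : ψ (2 • s - b₁ - b₂) = ψ s ^ 2 * ψ (-b₁) * ψ (-b₂) := by
    rw [show 2 • s - b₁ - b₂ = s + s + -b₁ + -b₂ by abel]
    simp only [AddChar.map_add_eq_mul]; ring
  have e2 : ψ (b₁ + b₂ - 2 • s) = ψ b₁ * ψ b₂ * ψ (-s) ^ 2 := by
    rw [show b₁ + b₂ - 2 • s = b₁ + b₂ + -s + -s by abel]
    simp only [AddChar.map_add_eq_mul]; ring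
  have hu : ∀ b : B, ψ b * ψ (-b) = 1 := fun b => by
    rw [← AddChar.map_add_eq_mul, add_neg_cancel, AddChar.map_zero_eq_one]
  have e3 : ψ (b₁ + b₂) * ψ (2 • s - b₁ - b₂) = ψ s ^ 2 := by
    rw [e1, AddChar.map_add_eq_mul]
    linear_combination (ψ s ^ 2 * ψ b₂ * ψ (-b₂)) * hu b₁ + ψ s ^ 2 * hu b₂
  rw [show ψ (b₁ + b₂) ^ j.val * (ψ (2 • s - b₁ - b₂) ^ j.val + ψ (b₁ + b₂ - 2 • s) ^ j.val - 1) =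
      (ψ (b₁ + b₂) * ψ (2 • s - b₁ - b₂)) ^ j.val + (ψ (b₁ + b₂) * ψ (b₁ + b₂ - 2 • s)) ^ j.val - ψ (b₁ + b₂) ^ j.val by
    rw [mul_pow, mul_pow]; ring, e3, e2, AddChar.map_add_eq_mul]
  simp only [AddChar.inv_apply, AddChar.pow_apply]
  ring

/-- **Product of the unit equations over the Galois orbit**:
`(∏_{j≠0} D(F,ψ^j)) · (∏_{j≠0} D(G,ψ^j)) = 1`. [folklore] -/
theorem prodD_mul_prodD (hp5 : 5 ≤ p) (hexp : ∀ b : B, p • b = 0) (F G : B → ℕ) (b₁ b₂ s : B) (K : ℕ)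
    (hID : ∀ t : B, (∑ u, (F (t - u) + F (u - (t - b₁)) + F ((t - b₂) + u)) * G u) +
      (if s = t then 1 else 0) = K)
    {ψ : AddChar B ℂ} (hψ : ψ ≠ 0) :
    (∏ j ∈ (univ : Finset (ZMod p)).erase 0, Dval F b₁ (ψ ^ j.val)) *
      (∏ j ∈ (univ : Finset (ZMod p)).erase 0, Dval G b₂ (ψ ^ j.val)) = 1 := by
  have hp2 : p ≠ 2 := by omega
  rw [← prod_mul_distrib, prod_congr rfl fun j hj => Dval_mul_Dval_pow hexp F G b₁ b₂ s K hID hψ (ne_of_mem_erase hj),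
    Finset.prod_erase (s := univ) (a := (0 : ZMod p))
      (f := fun j : ZMod p => ψ (b₁ + b₂) ^ j.val * (ψ (2 • s - b₁ - b₂) ^ j.val + ψ (b₁ + b₂ - 2 • s) ^ j.val - 1))
      (by simp),
    prod_mul_distrib, prod_pow_val_eq_one hp2 (addChar_apply_pow_p hexp ψ _), one_mul]
  refine prod_pow_add_pow_sub_one_eq_one hp5 (addChar_apply_pow_p hexp ψ _) ?_
  rw [← AddChar.map_add_eq_mul, show 2 • s - b₁ - b₂ + (b₁ + b₂ - 2 • s) = 0 by abel, AddChar.map_zero_eq_one]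

omit [DecidableEq B] in
/-- The `D`-values are algebraic integers. [folklore] -/
theorem isIntegral_Dval (hexp : ∀ b : B, p • b = 0) (F : B → ℕ) (b₁ : B) (χ : AddChar B ℂ) :
    IsIntegral ℤ (Dval F b₁ χ) := by
  have hn : ∀ n : ℕ, IsIntegral ℤ (n : ℂ) := fun n => by
    have : ((n : ℤ) : ℂ) = (n : ℂ) := by push_cast; rfl
    rw [← this]; exact isIntegral_algebraMap
  have hc : ∀ χ' : AddChar B ℂ, IsIntegral ℤ (chs F χ') := fun χ' =>
    IsIntegral.sum _ fun v _ => (hn _).mul (isIntegral_addChar_apply hexp χ' v)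
  unfold Dval Dsh
  have hb := isIntegral_addChar_apply hexp χ b₁
  exact (((hc χ).pow 2).add ((hb.mul (hc χ)).mul (hc χ⁻¹))).add ((hb.pow 2).mul ((hc χ⁻¹).pow 2))

omit [DecidableEq B] in
/-- The orbit product `∏_{j≠0} D(F,ψ^j)` is a nonnegative real. [folklore] -/
theorem prodD_nonneg (hp2 : p ≠ 2) (hexp : ∀ b : B, p • b = 0) (F : B → ℕ) (b₁ : B) (ψ : AddChar B ℂ) :
    ∃ r : ℝ, 0 ≤ r ∧ ∏ j ∈ (univ : Finset (ZMod p)).erase 0, Dval F b₁ (ψ ^ j.val) = (r : ℂ) :=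
  prod_erase_zero_nonneg hp2 (fun j => Dval F b₁ (ψ ^ j.val)) fun j => by
    rw [addChar_pow_val_neg hexp, conj_Dval]

/-! ## The full orbit product as ONE character sum -/

/-- The three signed points of a pair `(v, v')` (index `k`): `v + v'`, `b₁ + v − v'`, `2b₁ − v − v'`. [folklore] -/
def qpt (b₁ : B) (ω : B × B × Fin 3) : B :=
  ![ω.1 + ω.2.1, b₁ + ω.1 - ω.2.1, 2 • b₁ - ω.1 - ω.2.1] ω.2.2

omit [DecidableEq B] in
/-- `D(F, ψ^n)` expanded as a sum over pairs and types. [folklore] -/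
theorem Dval_pow_eq_sum (F : B → ℕ) (b₁ : B) (ψ : AddChar B ℂ) (n : ℕ) :
    Dval F b₁ (ψ ^ n) = ∑ ω : B × B × Fin 3, ((F ω.1 * F ω.2.1 : ℕ) : ℂ) * ψ (n • qpt b₁ ω) := by
  rw [Fintype.sum_prod_type]
  simp_rw [Fintype.sum_prod_type (f := fun x : B × Fin 3 => ((F _ * F x.1 : ℕ) : ℂ) * ψ (n • qpt b₁ (_, x))),
    Fin.sum_univ_three]
  simp only [qpt, Matrix.cons_val_zero, Matrix.cons_val_one, Matrix.cons_val]
  unfold Dval Dsh chs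
  simp only [AddChar.pow_apply, AddChar.inv_apply]
  have hn : ∀ x : B, ψ (n • x) = ψ x ^ n := fun x => AddChar.map_nsmul_eq_pow ψ n x
  simp_rw [sum_add_distrib, hn]
  rw [pow_two, pow_two (∑ v, (F v : ℂ) * ψ (-v) ^ n), sum_mul_sum, mul_assoc (ψ b₁ ^ n), sum_mul_sum, mul_sum,
    sum_mul_sum, mul_sum]
  simp_rw [mul_sum]
  congr 1; congr 1
  · refine sum_congr rfl fun v _ => sum_congr rfl fun v' _ => ?_
    push_cast; rw [AddChar.map_add_eq_mul]; ring
  · refine sum_congr rfl fun v _ => sum_congr rfl fun v' _ => ?_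
    push_cast
    rw [show b₁ + v - v' = b₁ + v + -v' by abel, AddChar.map_add_eq_mul, AddChar.map_add_eq_mul]; ring
  · refine sum_congr rfl fun v _ => sum_congr rfl fun v' _ => ?_
    push_cast
    rw [show 2 • b₁ - v - v' = b₁ + b₁ + -v + -v' by abel, AddChar.map_add_eq_mul, AddChar.map_add_eq_mul,
      AddChar.map_add_eq_mul]; ring

variable (p) in
/-- The full orbit product `∏_{j : ZMod p} D(F, ψ^j)`. [folklore] -/
noncomputable def normD (F : B → ℕ) (b₁ : B) (ψ : AddChar B ℂ) : ℂ := ∏ j : ZMod p, Dval F b₁ (ψ ^ j.val)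

variable (p) in
/-- Weight of an expansion term. [folklore] -/
def wt (F : B → ℕ) (ω : ZMod p → B × B × Fin 3) : ℕ := ∏ j, F (ω j).1 * F (ω j).2.1

variable (p) in
/-- Point of an expansion term. [folklore] -/
def pt (b₁ : B) (ω : ZMod p → B × B × Fin 3) : B := ∑ j : ZMod p, (j.val • qpt b₁ (ω j))

variable (p) in
/-- **The coefficient function** `E(b) = Σ_{pt ω = b} wt ω` — an integer-valued function on `B` whose character sums are the
orbit products. [folklore] -/
def coeffE (F : B → ℕ) (b₁ : B) (b : B) : ℤ := ∑ ω ∈ univ.filter (fun ω : ZMod p → B × B × Fin 3 => pt p b₁ ω = b), (wt p F ω : ℤ)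

omit [Fintype B] [DecidableEq B] in
/-- A character turns sums into products. [folklore] -/
theorem addChar_map_sum {ι : Type*} (ψ : AddChar B ℂ) (s : Finset ι) (x : ι → B) :
    ψ (∑ i ∈ s, x i) = ∏ i ∈ s, ψ (x i) := by
  classical
  induction s using Finset.induction_on with
  | empty => simp
  | insert a s ha ih => rw [sum_insert ha, prod_insert ha, AddChar.map_add_eq_mul, ih]

omit [DecidableEq B] in
/-- The orbit product expanded. [folklore] -/
theorem normD_eq_sum_wt (F : B → ℕ) (b₁ : B) (ψ : AddChar B ℂ) :
    normD p F b₁ ψ = ∑ ω : ZMod p → B × B × Fin 3, (wt p F ω : ℂ) * ψ (pt p b₁ ω) := by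
  unfold normD
  simp_rw [Dval_pow_eq_sum]
  rw [Fintype.prod_sum]
  refine sum_congr rfl fun ω _ => ?_
  rw [prod_mul_distrib, wt, pt, addChar_map_sum]
  push_cast
  rfl

/-- **The orbit product is the character sum of `E`.** [folklore] -/
theorem normD_eq_charsum (F : B → ℕ) (b₁ : B) (ψ : AddChar B ℂ) :
    normD p F b₁ ψ = ∑ b, (coeffE p F b₁ b : ℂ) * ψ b := by
  rw [normD_eq_sum_wt]
  symm
  calc ∑ b, (coeffE p F b₁ b : ℂ) * ψ b
      = ∑ b, ∑ ω ∈ univ.filter (fun ω : ZMod p → B × B × Fin 3 => pt p b₁ ω = b),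
          (wt p F ω : ℂ) * ψ (pt p b₁ ω) := by
        refine sum_congr rfl fun b _ => ?_
        rw [coeffE]; push_cast
        rw [sum_mul]
        exact sum_congr rfl fun ω hω => by rw [(mem_filter.1 hω).2]
    _ = _ := sum_fiberwise_of_maps_to (fun _ _ => mem_univ _) _

omit [DecidableEq B] in
/-- Value at the trivial character: `(3 (Σ F)²)^p`. [folklore] -/
theorem normD_one (F : B → ℕ) (b₁ : B) : normD p F b₁ 1 = (3 * ((∑ v, F v : ℕ) : ℂ) ^ 2) ^ p := by
  unfold normD
  simp_rw [one_pow, Dval_one]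
  rw [prod_const, card_univ, ZMod.card]

/-- The total mass of `E` is `(3 (Σ F)²)^p`. [folklore] -/
theorem sum_coeffE (F : B → ℕ) (b₁ : B) : ((∑ b, coeffE p F b₁ b : ℤ) : ℂ) = (3 * ((∑ v, F v : ℕ) : ℂ) ^ 2) ^ p := by
  rw [← normD_one (p := p) F b₁, normD_eq_charsum]
  push_cast
  simp

omit [DecidableEq B] in
/-- Galois invariance: `normD (ψ^l) = normD ψ` for `l ≢ 0`. [folklore] -/
theorem normD_pow (hexp : ∀ b : B, p • b = 0) (F : B → ℕ) (b₁ : B) (ψ : AddChar B ℂ) {l : ZMod p} (hl : l ≠ 0) :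
    normD p F b₁ (ψ ^ l.val) = normD p F b₁ ψ := by
  unfold normD
  simp_rw [← addChar_pow_val_mul hexp]
  exact Fintype.prod_equiv (Equiv.mulLeft₀ l hl) _ _ (fun j => rfl)

/-- **Galois averaging**: the orbit product `∏_{j≠0} D(F, ψ^j)` is a rational number. [folklore] -/
theorem exists_rat_prodD (hexp : ∀ b : B, p • b = 0) (F : B → ℕ) (b₁ : B) (ψ : AddChar B ℂ)
    (hF : 0 < ∑ v, F v) :
    ∃ q : ℚ, ∏ j ∈ (univ : Finset (ZMod p)).erase 0, Dval F b₁ (ψ ^ j.val) = (q : ℂ) := by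
  set d : ℕ := ∑ v, F v with hd
  -- the full product is `3d²` times the product over `j ≠ 0`
  have hsplit : normD p F b₁ ψ = 3 * (d : ℂ) ^ 2 * ∏ j ∈ (univ : Finset (ZMod p)).erase 0, Dval F b₁ (ψ ^ j.val) := by
    rw [normD, ← Finset.mul_prod_erase univ _ (mem_univ (0 : ZMod p)), ZMod.val_zero, pow_zero, Dval_one]
  -- averaging over `l`
  have h1 : ∑ l : ZMod p, normD p F b₁ (ψ ^ l.val) = normD p F b₁ 1 + ((p - 1 : ℕ) : ℂ) * normD p F b₁ ψ := by
    rw [← Finset.add_sum_erase univ _ (mem_univ (0 : ZMod p)), ZMod.val_zero, pow_zero,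
      sum_congr rfl fun l hl => normD_pow hexp F b₁ ψ (ne_of_mem_erase hl), sum_const, card_erase_of_mem (mem_univ _),
      card_univ, ZMod.card, nsmul_eq_mul]
  set M : ℤ := ∑ b ∈ univ.filter (fun b : B => ψ b = 1), coeffE p F b₁ b with hM
  have h2 : ∑ l : ZMod p, normD p F b₁ (ψ ^ l.val) = (p : ℂ) * M := by
    simp_rw [normD_eq_charsum, AddChar.pow_apply]
    rw [sum_comm]
    simp_rw [← mul_sum, sum_pow_val (addChar_apply_pow_p hexp ψ _), mul_ite, mul_zero]
    rw [← sum_filter, hM]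
    push_cast
    rw [mul_sum]
    exact sum_congr rfl fun b _ => by ring
  have hp1 : ((p - 1 : ℕ) : ℂ) ≠ 0 := by
    have : 1 < p := hp.out.one_lt
    exact_mod_cast (show (p - 1 : ℕ) ≠ 0 by omega)
  have hd0 : (d : ℂ) ≠ 0 := by exact_mod_cast hF.ne'
  refine ⟨(((p : ℤ) * M - (3 * (d : ℤ) ^ 2) ^ p : ℤ) : ℚ) / ((p - 1 : ℕ) : ℚ) / (3 * (d : ℚ) ^ 2), ?_⟩
  have key : ((p - 1 : ℕ) : ℂ) * (3 * (d : ℂ) ^ 2 * ∏ j ∈ (univ : Finset (ZMod p)).erase 0, Dval F b₁ (ψ ^ j.val)) =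
      (p : ℂ) * M - (3 * (d : ℂ) ^ 2) ^ p := by
    rw [← hsplit, ← h2, h1, normD_one]; ring
  push_cast
  field_simp
  linear_combination key

/-- **The orbit product is `1`** at every non-trivial character. [folklore] -/
theorem prodD_eq_one (hp5 : 5 ≤ p) (hexp : ∀ b : B, p • b = 0) (F G : B → ℕ) (b₁ b₂ s : B) (K : ℕ)
    (hID : ∀ t : B, (∑ u, (F (t - u) + F (u - (t - b₁)) + F ((t - b₂) + u)) * G u) +
      (if s = t then 1 else 0) = K)
    (hF : 0 < ∑ v, F v) (hG : 0 < ∑ v, G v) {ψ : AddChar B ℂ} (hψ : ψ ≠ 0) :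
    ∏ j ∈ (univ : Finset (ZMod p)).erase 0, Dval F b₁ (ψ ^ j.val) = 1 := by
  have hp2 : p ≠ 2 := by omega
  obtain ⟨qF, hqF⟩ := exists_rat_prodD hexp F b₁ ψ hF
  obtain ⟨qG, hqG⟩ := exists_rat_prodD hexp G b₂ ψ hG
  have hiF : IsIntegral ℤ (∏ j ∈ (univ : Finset (ZMod p)).erase 0, Dval F b₁ (ψ ^ j.val)) :=
    IsIntegral.prod _ fun j _ => isIntegral_Dval hexp F b₁ _
  have hiG : IsIntegral ℤ (∏ j ∈ (univ : Finset (ZMod p)).erase 0, Dval G b₂ (ψ ^ j.val)) :=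
    IsIntegral.prod _ fun j _ => isIntegral_Dval hexp G b₂ _
  obtain ⟨nF, hnF⟩ := exists_int_of_isIntegral_of_eq_rat hiF hqF
  obtain ⟨nG, hnG⟩ := exists_int_of_isIntegral_of_eq_rat hiG hqG
  have hprod := prodD_mul_prodD hp5 hexp F G b₁ b₂ s K hID hψ
  rw [hnF, hnG] at hprod
  have hprodZ : nF * nG = 1 := by exact_mod_cast hprod
  obtain ⟨r, hr, hrF⟩ := prodD_nonneg hp2 hexp F b₁ ψ
  rw [hnF] at hrF
  have hnF0 : 0 ≤ nF := by
    have : (nF : ℝ) = r := by exact_mod_cast hrF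
    exact_mod_cast this ▸ hr
  rw [hnF, Int.eq_one_of_mul_eq_one_right hnF0 hprodZ, Int.cast_one]

/-- **Mass identity**: `3 (Σ F)(Σ G) + 1 = K · |B|`. [folklore] -/
theorem three_mul_mass_add_one (F G : B → ℕ) (b₁ b₂ s : B) (K : ℕ)
    (hID : ∀ t : B, (∑ u, (F (t - u) + F (u - (t - b₁)) + F ((t - b₂) + u)) * G u) +
      (if s = t then 1 else 0) = K) :
    3 * (∑ v, F v) * (∑ v, G v) + 1 = K * Fintype.card B := by
  have h : ∑ t, ((∑ u, (F (t - u) + F (u - (t - b₁)) + F ((t - b₂) + u)) * G u) + (if s = t then 1 else 0)) =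
      ∑ t : B, K := sum_congr rfl fun t _ => hID t
  rw [sum_const, card_univ, smul_eq_mul, mul_comm, sum_add_distrib, Finset.sum_ite_eq, if_pos (mem_univ _),
    sum_comm] at h
  have hin : ∀ u, ∑ t, (F (t - u) + F (u - (t - b₁)) + F ((t - b₂) + u)) * G u = 3 * (∑ v, F v) * G u := by
    intro u
    rw [← sum_mul, sum_add_distrib, sum_add_distrib]
    have e1 : ∑ t, F (t - u) = ∑ v, F v := Equiv.sum_comp (Equiv.subRight u) F
    have e2 : ∑ t, F (u - (t - b₁)) = ∑ v, F v := by
      rw [← Equiv.sum_comp (Equiv.subLeft (u + b₁)) F]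
      exact sum_congr rfl fun t _ => by rw [Equiv.subLeft_apply]; congr 1; abel
    have e3 : ∑ t, F ((t - b₂) + u) = ∑ v, F v := by
      rw [← Equiv.sum_comp (Equiv.addRight (u - b₂)) F]
      exact sum_congr rfl fun t _ => by rw [Equiv.coe_addRight]; congr 1; abel
    rw [e1, e2, e3]; ring
  simp_rw [hin] at h
  rw [← mul_sum] at h
  exact h

/-- **THE NORM CONGRUENCE.**  `B` finite abelian of exponent `p ≥ 5` prime; `F, G, b₁, b₂, s, K` satisfying the shifted line
identity.  Then `|B| ∣ (3 (Σ F)²)^{p−1} − 1`. [folklore] -/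
theorem card_dvd_of_shifted_line_identity (hp5 : 5 ≤ p) (hexp : ∀ b : B, p • b = 0) (F G : B → ℕ) (b₁ b₂ s : B)
    (K : ℕ)
    (hID : ∀ t : B, (∑ u, (F (t - u) + F (u - (t - b₁)) + F ((t - b₂) + u)) * G u) +
      (if s = t then 1 else 0) = K) :
    Fintype.card B ∣ (3 * (∑ v, F v) ^ 2) ^ (p - 1) - 1 := by
  have hp1 : 1 ≤ p - 1 := by have := hp.out.one_lt; omega
  set d : ℕ := ∑ v, F v with hd
  set e : ℕ := ∑ v, G v with he
  have hmass := three_mul_mass_add_one F G b₁ b₂ s K hID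
  rw [← hd, ← he] at hmass
  -- degenerate masses
  rcases Nat.eq_zero_or_pos d with hd0 | hdpos
  · rw [hd0]; simp [Nat.zero_pow hp1]
  rcases Nat.eq_zero_or_pos e with he0 | hepos
  · -- `1 = K |B|` forces `|B| = 1`
    rw [he0, mul_zero, zero_add] at hmass
    exact Nat.dvd_trans (Dvd.intro_left _ hmass.symm) (one_dvd _)
  -- character sums of `E` are the constant `3d²`
  have hconst : ∀ ψ : AddChar B ℂ, ψ ≠ 0 → ∑ b, (coeffE p F b₁ b : ℂ) * ψ b = ((3 * (d : ℤ) ^ 2 : ℤ) : ℂ) := by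
    intro ψ hψ
    rw [← normD_eq_charsum, normD, ← Finset.mul_prod_erase univ _ (mem_univ (0 : ZMod p)), ZMod.val_zero, pow_zero,
      Dval_one, prodD_eq_one hp5 hexp F G b₁ b₂ s K hID hdpos hepos hψ, ← hd]
    push_cast; ring
  have hdvd := card_dvd_of_charsum_const (coeffE p F b₁) (3 * (d : ℤ) ^ 2) hconst
  have hsum : (∑ b, coeffE p F b₁ b : ℤ) = (3 * (d : ℤ) ^ 2) ^ p := by
    have := sum_coeffE (p := p) F b₁
    rw [← hd] at this
    exact_mod_cast this
  rw [hsum] at hdvd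
  -- `(3d²)^p − 3d² = 3d² ((3d²)^{p−1} − 1)` and `gcd(|B|, 3d²) = 1`
  have hfac : (3 * (d : ℤ) ^ 2) ^ p - 3 * (d : ℤ) ^ 2 = (((3 * d ^ 2) ^ (p - 1) - 1 : ℕ) : ℤ) * (3 * (d : ℤ) ^ 2) := by
    have hle : 1 ≤ (3 * d ^ 2) ^ (p - 1) := Nat.one_le_pow _ _ (by positivity)
    push_cast [Nat.cast_sub hle]
    rw [show p = (p - 1) + 1 from by omega, pow_succ]
    simp only [Nat.add_sub_cancel]
    ring
  rw [hfac] at hdvd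
  have hcop : IsCoprime (Fintype.card B : ℤ) (3 * (d : ℤ) ^ 2) := by
    have h3de : IsCoprime (Fintype.card B : ℤ) (3 * (d : ℤ) * e) := by
      refine ⟨K, -1, ?_⟩
      have := congrArg (fun n : ℕ => (n : ℤ)) hmass
      push_cast at this
      linear_combination (-1 : ℤ) * this
    have h3 : IsCoprime (Fintype.card B : ℤ) 3 := (h3de.of_mul_right_left).of_mul_right_left
    have hdd : IsCoprime (Fintype.card B : ℤ) d := (h3de.of_mul_right_left).of_mul_right_right
    rw [pow_two, ← mul_assoc]
    exact (h3.mul_right hdd).mul_right hdd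
  have := hcop.dvd_of_dvd_mul_right hdvd
  exact_mod_cast this

/-- **The norm congruence for the second set**: `|B| ∣ (3 (Σ G)²)^{p−1} − 1`, by the symmetry `(F, b₁) ↔ (G, b₂)` of the
character form. [folklore] -/
theorem card_dvd_of_shifted_line_identity' (hp5 : 5 ≤ p) (hexp : ∀ b : B, p • b = 0) (F G : B → ℕ) (b₁ b₂ s : B)
    (K : ℕ)
    (hID : ∀ t : B, (∑ u, (F (t - u) + F (u - (t - b₁)) + F ((t - b₂) + u)) * G u) +
      (if s = t then 1 else 0) = K) :
    Fintype.card B ∣ (3 * (∑ v, G v) ^ 2) ^ (p - 1) - 1 := by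
  have hp1 : 1 ≤ p - 1 := by have := hp.out.one_lt; omega
  set d : ℕ := ∑ v, F v with hd
  set e : ℕ := ∑ v, G v with he
  have hmass := three_mul_mass_add_one F G b₁ b₂ s K hID
  rw [← hd, ← he] at hmass
  have hF := card_dvd_of_shifted_line_identity hp5 hexp F G b₁ b₂ s K hID
  rw [← hd] at hF
  rcases Nat.eq_zero_or_pos e with he0 | hepos
  · rw [he0]; simp [Nat.zero_pow hp1]
  rcases Nat.eq_zero_or_pos d with hd0 | hdpos
  · -- `1 = K |B|` forces `|B| = 1`
    rw [hd0, mul_zero, zero_mul, zero_add] at hmass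
    exact Nat.dvd_trans (Dvd.intro_left _ hmass.symm) (one_dvd _)
  -- `(3e²)(3d²) ≡ 1` and `(3d²)^{p-1} ≡ 1` give `(3e²)^{p-1} ≡ 1` (mod |B|)
  have hN : (Fintype.card B : ℤ) ∣ 3 * (d : ℤ) * e + 1 := ⟨K, by exact_mod_cast hmass.trans (mul_comm _ _)⟩
  have h1 : (Fintype.card B : ℤ) ∣ (3 * (d : ℤ) ^ 2) * (3 * (e : ℤ) ^ 2) - 1 := by
    have : (3 * (d : ℤ) ^ 2) * (3 * (e : ℤ) ^ 2) - 1 = (3 * (d : ℤ) * e + 1) * (3 * d * e - 1) := by ring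
    rw [this]; exact Dvd.dvd.mul_right hN _
  have h2 : (Fintype.card B : ℤ) ∣ ((3 * (d : ℤ) ^ 2) * (3 * (e : ℤ) ^ 2)) ^ (p - 1) - 1 := by
    have := sub_one_dvd_pow_sub_one ((3 * (d : ℤ) ^ 2) * (3 * (e : ℤ) ^ 2)) (p - 1)
    exact dvd_trans h1 (by simpa using this)
  have hF' : (Fintype.card B : ℤ) ∣ (3 * (d : ℤ) ^ 2) ^ (p - 1) - 1 := by
    have hle : 1 ≤ (3 * d ^ 2) ^ (p - 1) := Nat.one_le_pow _ _ (by positivity)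
    have := Int.natCast_dvd_natCast.2 hF
    push_cast [Nat.cast_sub hle] at this
    exact this
  -- combine: x^k y^k − 1 − y^k (x^k − 1) = y^k − 1
  have h3 : (Fintype.card B : ℤ) ∣ (3 * (e : ℤ) ^ 2) ^ (p - 1) - 1 := by
    have e1 : ∀ X Y : ℤ, Y - 1 = (X * Y - 1) - Y * (X - 1) := fun X Y => by ring
    rw [mul_pow] at h2
    rw [e1 ((3 * (d : ℤ) ^ 2) ^ (p - 1)) ((3 * (e : ℤ) ^ 2) ^ (p - 1))]
    exact dvd_sub h2 (Dvd.dvd.mul_left hF' _)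
  have hle : 1 ≤ (3 * e ^ 2) ^ (p - 1) := Nat.one_le_pow _ _ (by positivity)
  have : ((Fintype.card B : ℕ) : ℤ) ∣ (((3 * e ^ 2) ^ (p - 1) - 1 : ℕ) : ℤ) := by push_cast [Nat.cast_sub hle]; exact h3
  exact_mod_cast this

end Norm

end Summit.MatrixMultiplication.OmegaCensus.DominoNorm
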